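/-
Copyright: the b2b-balaban T⁴-continuum CRUX team, row NE7b OWNER lineage `t4-ne7b-p1` (gen 126). Project licence.
-/
import Summits.QuantumFields.BalabanUV.T4Continuum.Spine.NE7b.SupZdCouplingWindowStep
import Summits.QuantumFields.BalabanUV.T4Continuum.Spine.NE7b.SupZdSoftStepCouplings

/-!
# (255)'s COMPOSED COUPLINGS ARE COVERED FROM THE REFERENCE COUPLING, FOR EVERY MESH BEYOND TWO EXPLICIT THRESHOLDS: on `ℤ^d`, if the
# `H + K` column's package holds at the road's coupling `a` with constants `(C_Ψ, μ; C_G; C_N, ν_N)` and the mesh `n` satisfies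
# `e^{2νd}K_1K_{μ−ν}C_Ψ·a(n+1)^{−d} ≤ 1∕2` and `C_G·a(n+1)^{−d} ≤ 1∕2`, then the package holds — with (264)'s constants — at EVERY composed
# coupling `c_k` of (255) (`c_0 = a`, `c_{k+1} = c_ka(n+1)^d∕(c_k(n+1)^d + a)`, all in `(a(1 − (n+1)^{−d}), a]`), uniformly in `k`: the
# large-mesh half of «iterability by mesh-uniformity» for the quadratic part of the road, by ONE window step (row NE7b, node U5c;
# (255)∕(264) BY NAME; [folklore])

Cell `pub-balaban`, sub-cell `t4`, spine estimate NE7b (`T4WeightBudget.RelWeightBound`; the cell's OWN estimate — NOT PRINTED in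
[Bałaban 1983–89], NOT PROVED).  Crux-route work under `Spine/NE7b/` by the row OWNER (`t4-ne7b-p1` gen 126, file (268)) under FREEZE
(0)'s crux-prover clause, on § [NE7bP1-G125-HANDOFF] NEXT (3)(a); NOTHING of Bałaban's is named as a Lean object, valued or asserted; no
`T4Continuum/Support` leaf typed; no `def`, no notation (the package at `a` is ANY data with (264)'s displayed clauses); zero `sorry`.
Imports (BY NAME): the OWNER's (264) `…SupZdCouplingWindowStep` (`coupling_window_step`), (255) `…SupZdSoftStepCouplings`
(`zd_soft_coupling_bounds`).

WHY (located).  (255) showed that `k` composed soft block-spin steps carry the coupling `c_k ∈ (a(1 − (n+1)^{−d}), a]`, so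
`|c_k − a| < a(n+1)^{−d}`; (264) moves the package from `a` to any `a′` within two thresholds linear in `|a′ − a|`.  Hence two conditions on
the MESH alone (reference constants fixed) put every `c_k` inside the window step's ball — for those meshes the whole composed tower has
the package with ONE set of constants, independent of `k`.  The finitely many meshes below the thresholds are the compactness scheme of
(266) (several base couplings), recorded there.

WHAT IS PROVED ([folklore]): §1 `thresholds_of_mesh` (the two mesh conditions and `|c − a| ≤ a(n+1)^{−d}` give (264)'s two thresholds at
`c`); §2 THE END **`package_along_composed_couplings`** (package at `a` + the two mesh conditions ⟹ for every `k`, (264)'s conclusion at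
`a′ = c_k`); §3 toy.

HONEST (what this is NOT).  A corollary of (255) + (264); small meshes not covered here ((266)'s scheme); constants are (264)'s (one
step, no iteration in `k`); scalar skeleton ((A3), NC-NE7b-α UNRULED); nothing of the torus; nothing of Bałaban's asserted.  BY-NAME EFFECT
ON THE WALL: NONE.  NE7b NOT PRINTED ∕ NOT PROVED; spine PROVED 0∕9; rung (B)+1 — the programme's measures remain FINITE-torus statements;
NOT the mass gap, NOT Clay.  HONEST DEPENDENCY: continuum YM on T⁴ ⇐ BetaPertH ∧ nine spine estimates (0∕9 proved); BetaPertH ⇐ (D1) ∧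
(D4) ∧ CAP+tail; G-an2-4 gates asym, D1 and NE2∕3∕4.
-/

set_option autoImplicit false

noncomputable section

namespace Summit.QuantumFields.BalabanUV.T4Continuum.NE7b.SupZdCouplingWindowLargeMesh

open Real Filter Topology
open scoped ENNReal
open Literature.MathematicalPhysics.QuantumFieldTheory.Balaban1983to89
open B6QGQLower276 (X e blk B mem_B sum_B_const)
open SupZdCouplingWindowStep (coupling_window_step)
open SupZdSoftStepCouplings (zd_soft_coupling_bounds)

variable {d : ℕ}

/-! ## §1. The mesh conditions give the thresholds on the whole window -/

/-- **THRESHOLDS FROM THE MESH**: `0 ≤ C_Ψ, C_G`, `e^{νd}K_1·(a(n+1)^{−d}C_Ψe^{νd}K_{μ−ν}) ≤ 1∕2`, `a(n+1)^{−d}C_G ≤ 1∕2` and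
`|c − a| ≤ a(n+1)^{−d}` ⟹ (264)'s two thresholds at `a′ = c`. [folklore] -/
theorem thresholds_of_mesh (n : ℕ) (a c : ℝ) {μ ν CΨ CG : ℝ} (hCΨ : 0 ≤ CΨ) (hCG : 0 ≤ CG)
    (hm1 : (exp (ν * d) * (2 * (1 - exp (-1))⁻¹) ^ d)
      * (a * (((n : ℝ) + 1) ^ d)⁻¹ * CΨ * exp (ν * d) * (2 * (1 - exp (-(μ - ν)))⁻¹) ^ d) ≤ 1 / 2)
    (hm2 : a * (((n : ℝ) + 1) ^ d)⁻¹ * CG ≤ 1 / 2) (hνμ : ν < μ) (hc : |c - a| ≤ a * (((n : ℝ) + 1) ^ d)⁻¹) :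
    (exp (ν * d) * (2 * (1 - exp (-1))⁻¹) ^ d)
        * (|c - a| * CΨ * exp (ν * d) * (2 * (1 - exp (-(μ - ν)))⁻¹) ^ d) ≤ 1 / 2 ∧
      |c - a| * CG ≤ 1 / 2 := by
  have hK1 : 0 ≤ (2 * (1 - exp (-1 : ℝ))⁻¹) ^ d :=
    pow_nonneg (mul_nonneg zero_le_two (inv_nonneg.2 (sub_nonneg.2 (exp_le_one_iff.2 (by norm_num))))) d
  have hK2 : 0 ≤ (2 * (1 - exp (-(μ - ν)))⁻¹) ^ d :=
    pow_nonneg (mul_nonneg zero_le_two (inv_nonneg.2 (sub_nonneg.2 (exp_le_one_iff.2 (by linarith))))) d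
  constructor
  · refine le_trans ?_ hm1
    refine mul_le_mul_of_nonneg_left ?_ (by positivity)
    have h : |c - a| * CΨ ≤ a * (((n : ℝ) + 1) ^ d)⁻¹ * CΨ := mul_le_mul_of_nonneg_right hc hCΨ
    calc |c - a| * CΨ * exp (ν * d) * (2 * (1 - exp (-(μ - ν)))⁻¹) ^ d
        = (|c - a| * CΨ) * (exp (ν * d) * (2 * (1 - exp (-(μ - ν)))⁻¹) ^ d) := by ring
      _ ≤ (a * (((n : ℝ) + 1) ^ d)⁻¹ * CΨ) * (exp (ν * d) * (2 * (1 - exp (-(μ - ν)))⁻¹) ^ d) :=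
          mul_le_mul_of_nonneg_right h (by positivity)
      _ = _ := by ring
  · exact (mul_le_mul_of_nonneg_right hc hCG).trans hm2

/-! ## §2. THE END: the package along the composed couplings -/

/-- **HEADLINE — THE PACKAGE ALONG (255)'s COMPOSED COUPLINGS.**  For a mesh `n ≥ 1` in dimension `d ≥ 1`, the road's coupling `a > 0`, the
composed couplings `c_0 = a`, `c_{k+1} = c_ka(n+1)^d∕(c_k(n+1)^d + a)`, the package (P1)–(P4) at `a` as in (264) and the two MESH conditions
`e^{νd}K_1·(a(n+1)^{−d}C_Ψe^{νd}K_{μ−ν}) ≤ 1∕2`, `a(n+1)^{−d}C_G ≤ 1∕2`: for EVERY `k`, (264)'s conclusion holds at `a′ = c_k` — columns with profile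
`2e^{νd}K_1C_ΨK_{μ−ν}` at rate `ν`, a solution operator with `2C_G`, uniqueness of bounded solutions, and the two-sided inverse `N + (c_k − a)·1`;
constants independent of `k`. [folklore] -/
theorem package_along_composed_couplings (hd : 1 ≤ d) (n : ℕ) (hn : 1 ≤ n) (a : ℝ) (ha : 0 < a) (cs : ℕ → ℝ) (h0 : cs 0 = a)
    (hsucc : ∀ k, cs (k + 1) = cs k * a * ((n : ℝ) + 1) ^ d / (cs k * ((n : ℝ) + 1) ^ d + a))
    {ε γ μ ν ν' CΨ CG CN νN : ℝ} (hε : 0 ≤ ε) (hγ : 0 < γ) (hν' : 0 < ν') (hν'ν : ν' < ν) (hνμ : ν < μ) (hνN : 0 < νN)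
    (V : X d → ℝ) (K : X d → X d → ℝ) (hK : ∀ p q, |K p q| ≤ ε * exp (-(γ * ∑ i, (((p i - q i).natAbs : ℕ) : ℝ))))
    (Ψ : X d → X d → ℝ) (hΨd : ∀ c p, |Ψ c p| ≤ CΨ * exp (-(μ * ∑ i, (((blk n p i - c i).natAbs : ℕ) : ℝ))))
    (hΨ : ∀ c p, ((n : ℝ) + 1) ^ 2 * ∑ μ', (2 * Ψ c p - Ψ c (p + e μ') - Ψ c (p - e μ'))
        + a / ((n : ℝ) + 1) ^ d * ∑ q ∈ B n (blk n p), Ψ c q + V p * Ψ c p + ∑' q : X d, K p q * Ψ c q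
          = if blk n p = c then 1 else 0)
    (G : lp (fun _ : X d => ℝ) ∞ →L[ℝ] lp (fun _ : X d => ℝ) ∞) (hGn : ‖G‖ ≤ CG)
    (hG : ∀ (f : lp (fun _ : X d => ℝ) ∞) (p : X d),
      ((n : ℝ) + 1) ^ 2 * ∑ μ', (2 * G f p - G f (p + e μ') - G f (p - e μ'))
        + a / ((n : ℝ) + 1) ^ d * ∑ q ∈ B n (blk n p), G f q + V p * G f p + ∑' q : X d, K p q * G f q = f p)
    (hU : ∀ (f : X d → ℝ) (Mf : ℝ), (∀ p, |f p| ≤ Mf) → ∀ (u v : X d → ℝ) (Bu Bv : ℝ), (∀ p, |u p| ≤ Bu) → (∀ p, |v p| ≤ Bv) →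
        (∀ p, ((n : ℝ) + 1) ^ 2 * ∑ μ', (2 * u p - u (p + e μ') - u (p - e μ'))
          + a / ((n : ℝ) + 1) ^ d * ∑ q ∈ B n (blk n p), u q + V p * u p + ∑' q : X d, K p q * u q = f p) →
        (∀ p, ((n : ℝ) + 1) ^ 2 * ∑ μ', (2 * v p - v (p + e μ') - v (p - e μ'))
          + a / ((n : ℝ) + 1) ^ d * ∑ q ∈ B n (blk n p), v q + V p * v p + ∑' q : X d, K p q * v q = f p) →
        ∀ p, u p = v p)
    (N : X d → X d → ℝ) (hNd : ∀ b c, |N b c| ≤ CN * exp (-(νN * ∑ i, (((b i - c i).natAbs : ℕ) : ℝ))))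
    (hTN : ∀ b c', ∑' c : X d, ((((n : ℝ) + 1) ^ d)⁻¹ * ∑ q ∈ B n b, Ψ c q) * N c c' = if b = c' then 1 else 0)
    (hNT : ∀ c b, ∑' b' : X d, N c b' * ((((n : ℝ) + 1) ^ d)⁻¹ * ∑ q ∈ B n b', Ψ b q) = if c = b then 1 else 0)
    (hm1 : (exp (ν * d) * (2 * (1 - exp (-1))⁻¹) ^ d)
      * (a * (((n : ℝ) + 1) ^ d)⁻¹ * CΨ * exp (ν * d) * (2 * (1 - exp (-(μ - ν)))⁻¹) ^ d) ≤ 1 / 2)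
    (hm2 : a * (((n : ℝ) + 1) ^ d)⁻¹ * CG ≤ 1 / 2) (k : ℕ) :
    ∃ (Ψ' : X d → X d → ℝ) (G' : lp (fun _ : X d => ℝ) ∞ →L[ℝ] lp (fun _ : X d => ℝ) ∞),
      (∀ c p, |Ψ' c p| ≤ 2 * (exp (ν * d) * (2 * (1 - exp (-1))⁻¹) ^ d) * CΨ * (2 * (1 - exp (-(μ - ν)))⁻¹) ^ d
        * exp (-(ν * ∑ i, (((blk n p i - c i).natAbs : ℕ) : ℝ)))) ∧
      (∀ c p, ((n : ℝ) + 1) ^ 2 * ∑ μ', (2 * Ψ' c p - Ψ' c (p + e μ') - Ψ' c (p - e μ'))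
        + cs k / ((n : ℝ) + 1) ^ d * ∑ q ∈ B n (blk n p), Ψ' c q + V p * Ψ' c p + ∑' q : X d, K p q * Ψ' c q
          = if blk n p = c then 1 else 0) ∧
      (∀ f : lp (fun _ : X d => ℝ) ∞, ‖G' f‖ ≤ 2 * CG * ‖f‖) ∧
      (∀ (f : lp (fun _ : X d => ℝ) ∞) (p : X d),
        ((n : ℝ) + 1) ^ 2 * ∑ μ', (2 * G' f p - G' f (p + e μ') - G' f (p - e μ'))
          + cs k / ((n : ℝ) + 1) ^ d * ∑ q ∈ B n (blk n p), G' f q + V p * G' f p + ∑' q : X d, K p q * G' f q = f p) ∧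
      (∀ (f : X d → ℝ) (Mf : ℝ), (∀ p, |f p| ≤ Mf) → ∀ (u v : X d → ℝ) (Bu Bv : ℝ), (∀ p, |u p| ≤ Bu) → (∀ p, |v p| ≤ Bv) →
        (∀ p, ((n : ℝ) + 1) ^ 2 * ∑ μ', (2 * u p - u (p + e μ') - u (p - e μ'))
          + cs k / ((n : ℝ) + 1) ^ d * ∑ q ∈ B n (blk n p), u q + V p * u p + ∑' q : X d, K p q * u q = f p) →
        (∀ p, ((n : ℝ) + 1) ^ 2 * ∑ μ', (2 * v p - v (p + e μ') - v (p - e μ'))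
          + cs k / ((n : ℝ) + 1) ^ d * ∑ q ∈ B n (blk n p), v q + V p * v p + ∑' q : X d, K p q * v q = f p) →
        ∀ p, u p = v p) ∧
      (∀ b c', Summable (fun c : X d => ((((n : ℝ) + 1) ^ d)⁻¹ * ∑ q ∈ B n b, Ψ' c q) * (N c c' + (cs k - a) * (if c = c' then 1 else 0))) ∧
        ∑' c : X d, ((((n : ℝ) + 1) ^ d)⁻¹ * ∑ q ∈ B n b, Ψ' c q) * (N c c' + (cs k - a) * (if c = c' then 1 else 0))
          = if b = c' then 1 else 0) ∧
      (∀ c b, Summable (fun b' : X d => (N c b' + (cs k - a) * (if c = b' then 1 else 0))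
          * ((((n : ℝ) + 1) ^ d)⁻¹ * ∑ q ∈ B n b', Ψ' b q)) ∧
        ∑' b' : X d, (N c b' + (cs k - a) * (if c = b' then 1 else 0)) * ((((n : ℝ) + 1) ^ d)⁻¹ * ∑ q ∈ B n b', Ψ' b q)
          = if c = b then 1 else 0) := by
  have hCΨ : 0 ≤ CΨ := by
    have h := (abs_nonneg _).trans (hΨd 0 0); exact le_of_mul_le_mul_right (by rw [zero_mul]; exact h) (exp_pos _)
  have hCG : 0 ≤ CG := (norm_nonneg _).trans hGn
  -- `c_k` lies in the window, so `|c_k − a| ≤ a(n+1)^{−d}`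
  obtain ⟨hlo, hhi, -⟩ := zd_soft_coupling_bounds hd n hn ha cs h0 hsucc k
  have hvol : (0 : ℝ) < ((n : ℝ) + 1) ^ d := by positivity
  have hck : |cs k - a| ≤ a * (((n : ℝ) + 1) ^ d)⁻¹ := by
    rw [abs_sub_comm, abs_of_nonneg (by linarith)]
    have : a * (1 - (((n : ℝ) + 1) ^ d)⁻¹) = a - a * (((n : ℝ) + 1) ^ d)⁻¹ := by ring
    linarith
  obtain ⟨hs1, hs2⟩ := thresholds_of_mesh n a (cs k) hCΨ hCG hm1 hm2 hνμ hck
  exact coupling_window_step n a (cs k) hε hγ hν' hν'ν hνμ hνN V K hK Ψ hΨd hΨ G hGn hG hU N hNd hTN hNT hs1 hs2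

/-! ## §3. Toy -/

/-- Toy: with all reference constants zero, the two mesh conditions hold at every mesh (§1 then returns the thresholds at every `c`
of the window). -/
example (n : ℕ) (a ν μ : ℝ) :
    (exp (ν * (1 : ℕ)) * (2 * (1 - exp (-1))⁻¹) ^ 1)
        * (a * (((n : ℝ) + 1) ^ 1)⁻¹ * 0 * exp (ν * (1 : ℕ)) * (2 * (1 - exp (-(μ - ν)))⁻¹) ^ 1) ≤ 1 / 2 ∧
      a * (((n : ℝ) + 1) ^ 1)⁻¹ * 0 ≤ 1 / 2 := by
  constructor <;> simp

end Summit.QuantumFields.BalabanUV.T4Continuum.NE7b.SupZdCouplingWindowLargeMesh
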